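import Mathlib
import Literature.Computability.AlgebraicComplexity.StandardFamilies
import Literature.RingTheory.Nullstellensatz.SkodaBrownawellDegreeBound
import Summits.ValiantsHypothesis.ValiantsHypothesis.Theses.RefutationDegree
import Summits.ValiantsHypothesis.ValiantsHypothesis.Theorems.RefutationDegreeDefs
import Summits.ValiantsHypothesis.ValiantsHypothesis.Theorems.RefutationDegreeRefutationBarrierFanoByOne

/-!
# Crux `RefutationDegree.RefutationBarrier` (stmt-ValiantsHypothesis-5642) — line `Sketch_ideator4`
(idea `fano-by-one-border`, NEGATION lens): lead skeleton, v2

Everything of the line except its research content has LANDED: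
* L1a–d `stub_eventually_exists_root_near` p122535, `stub_exists_submodule_limit` p122483,
  `stub_tendsto_eval_of_tendsto_coeff` p122651, `stub_exists_kernelFlat` p122533; isotropy
  `stub_isotropic_of_null` p122581; L1 `stub_borderKernelPlane` p122909 (border-robust kernel plane);
* `RefutationDegreeRefutationBarrierFanoByOne`: L2 `null_sup_span_of_flat`, the border Fano bound
  `sq_le_add_of_inBorder`, the quadratic border bound `sq_le_two_mul_of_inBorder` (LMR13 Thm 1.1.1 in the
  affine-border model, by kernel planes), `not_inBorder_of_fanoByOne` (LMR13 + 1 at odd `n` from FanoByOne),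
  `not_refutationBarrier_of_fanoByOne_io` (FanoByOne i.o. ∧ SB ⟹ ¬ crux).

The ONE open stub is the research content `stub_fanoByOne_io`; the deciding theorem
`RefutationBarrierFalseModSB_proof : SB → ¬ RefutationBarrier` is kernel-checked modulo it.
-/

set_option linter.dupNamespace false

noncomputable section

namespace Summit.ValiantsHypothesis.ValiantsHypothesis.Theorems.RefutationDegree

open MvPolynomial
open Literature.Computability.AlgebraicComplexity (perPoly)
open Literature.RingTheory.Nullstellensatz (skodaBrownawellDegreeBound)
open Summit.ValiantsHypothesis.ValiantsHypothesis.Theses.RefutationDegree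

/-- **Stub (research content, `FanoByOne` infinitely often at odd `n`).**  For infinitely many odd `n`
some zero `y` of `per_n` lies on no linear per-null subspace of dimension `⌊n²/2⌋`: every linear
`W ∋ y` with `per_n|_W ≡ 0` has `dim W + 1 ≤ ⌊n²/2⌋` (one below the Lagrangian bound; expected at the
Mignon–Ressayre point `J − nE₁₁`, where conjecturally the maximum is `2n − 2`).  This is a border lower
bound `\overline{dc}_aff(per_n) ≥ ⌊n²/2⌋ + 2` at odd `n` (LMR13 + 1) in per-side form: research-sized. -/
theorem stub_fanoByOne_io : ∀ n₀ : ℕ, ∃ n ≥ n₀, Odd n ∧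
    ∃ y : Fin n × Fin n → ℂ, eval y (perPoly (Fin n) ℂ) = 0 ∧
      ∀ W : Submodule ℂ (Fin n × Fin n → ℂ), y ∈ W →
        (∀ w ∈ W, eval w (perPoly (Fin n) ℂ) = 0) → Module.finrank ℂ W + 1 ≤ n ^ 2 / 2 := by
  sorry

/-- **The line's deciding theorem: `¬ RefutationBarrier` modulo Skoda–Brownawell**, from the research
stub via the landed reduction `not_refutationBarrier_of_fanoByOne_io`. -/
theorem not_RefutationBarrier_of
    (hSB : ∀ n m : ℕ, skodaBrownawellDegreeBound (σ := Unk n m) (ι := (Fin n × Fin n) →₀ ℕ)) :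
    ¬ RefutationBarrier :=
  not_refutationBarrier_of_fanoByOne_io hSB stub_fanoByOne_io

/-- **What this NEGATION line settles** (the skeleton's deciding statement, used as `--crux-decl` for
`ledger skeleton check`, which matches conclusions by head symbol and cannot see through `¬`): the crux
`RefutationBarrier` is FALSE modulo the named analytic fact `skodaBrownawellDegreeBound`. -/
def RefutationBarrierFalseModSB : Prop :=
  (∀ n m : ℕ, skodaBrownawellDegreeBound (σ := Unk n m) (ι := (Fin n × Fin n) →₀ ℕ)) →
    ¬ RefutationBarrier

/-- The skeleton closes `RefutationBarrierFalseModSB` modulo the single registered stub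
`stub_fanoByOne_io`. -/
theorem RefutationBarrierFalseModSB_proof : RefutationBarrierFalseModSB :=
  fun hSB => not_RefutationBarrier_of hSB

end Summit.ValiantsHypothesis.ValiantsHypothesis.Theorems.RefutationDegree

end
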